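import Summits.FinalStateConjecture.FinalStateConjecture.Theorems.ClusterCompletenessOmegaLimitMultiKerrBirthDefs
import Summits.FinalStateConjecture.FinalStateConjecture.Theorems.PhotonSphereChannelsChannelsResolveTameDevelopmentsRMinkowskiMaximal
import HarnessLib

/-!
# Crux `ClusterCompleteness.OmegaLimitMultiKerr` (stmt-FinalStateConjecture-17639, rev 21) —
# small-model facts from the refuter's crux-attack (vetting cycle, 2026-08-17)

Negative-lane helpers (no Theses decl is asserted): the rev-21 recur interface `RecursO k`
(`ClusterCompletenessOmegaLimitMultiKerrBirthDefs`; VERBATIM the recur-disjunct of the crux and the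
hypothesis of the route target `RecurrentMultiKerrCapture`, i.e. the rev-16 interface PLUS honest radii,
`RaysStayInClosure`, orthochronous motions / future-directed flat chart time, and the orientation tail of
the recurrence clause) has an HONEST MODEL AT EVERY ORDER `k`: the Minkowski development of the trivial
datum, identity flat chart on `U₀ = ℝ⁴`, `τ₀ = 0`, no hole, `O = {x⁰ ≥ 0}`. Consequences recorded for
the crux chain and for the target's provers:

* `recursO_minkowski_vacuumCauchyDevelopment` — `∀ k, RecursO k Minkowski.vacuumCauchyDevelopment`;
* `settlesT2_and_recursO_minkowski` — the SAME development meets both disjuncts of the crux (T2 settle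
  matrix `SettlesT2`, tree theorem `TrivialDatum.settlesT2_minkowski`), so neither disjunct is typed
  junk-empty and `RecurrentMultiKerrCapture` has no `∃ k` shortcut through an unsatisfiable hypothesis;
* `omegaProperty_minkowski` — at the Minkowski development the `∀`-MGHD matrix of the
  crux's property holds outright (the settle branch fires), so with
  `TrivialDatum.settlesT2_of_isMaximal` (tree, module `…RTrivialDatumMGHD`) the dispersive end
  `(ℝ³, δ, 0)` is not exceptional at any order.

Everything is assembled from landed tree lemmas (pattern of
`ClusterCompletenessOmegaLimitMultiKerrMinkowskiRecurs.lean`, which did this for the rev-16 `Recurs`).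
References: Christodoulou–Klainerman 1993, Thm. 1.0.2; Dafermos–Luk arXiv:1710.01722, Conjecture 1;
O'Neill 1983, Ch. 14, p. 402.
-/

-- every `Summit.FinalStateConjecture.FinalStateConjecture.…` name repeats the summit = sub-problem segment (D-0017 layout)
set_option linter.dupNamespace false

noncomputable section

open Set Filter Function TopologicalSpace
open scoped Manifold ContDiff Topology ENNReal

namespace Summit.FinalStateConjecture.FinalStateConjecture.Theorems.OmegaLimitMultiKerr.Negative

open Literature.Geometry.Lorentzian Literature.Geometry.Lorentzian.Minkowski
open Summit.FinalStateConjecture.FinalStateConjecture.Theorems.ClusterCompleteness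
  (RecursO SettlesT2)
open Summit.FinalStateConjecture.FinalStateConjecture.Theorems.UniversalWitnessFamily.Negative
  (minkowskiExterior idFlatChart image_idFlatChart_lateRegion image_idFlatChart_timeSlab
    isLateChart_idFlatChart minkowskiExterior_eq_exteriorOf charted_minkowskiDecomp
    deviationExtend_idFlatChart)
open Summit.FinalStateConjecture.FinalStateConjecture.Theorems.ChannelsResolveTameDevelopmentsR.TrivialDatum
  (raysStayInClosure_minkowski settlesT2_minkowski)

/-- **The rev-21 recur interface has an honest model at every order.** The Minkowski development of
the trivial datum `(ℝ³, δ, 0)` satisfies `RecursO k` for every `k`: no hole (sub-extremality, hole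
charts, sublinear tubes, honest radii, separation, orthochronous motions and the orientation tail of
the recurrence clause are vacuous over `Fin 0`), flat domain `U₀ = ℝ⁴`, identity flat chart, `τ₀ = 0`,
`O = {x⁰ ≥ 0} = J⁺(ι ℝ³) ∩ I⁻({x⁰ > 0})`, every future-complete normalised null ray from the slice
stays in `O` (`TrivialDatum.raysStayInClosure_minkowski`), exhaustion by vertical timelike segments,
`∂₀` pushed forward to `∂ₜ` (future-directed at EVERY late flat slab, not only eventually), and all
deviations `0`. Christodoulou–Klainerman 1993, Thm. 1.0.2. [cite: ChristodoulouKlainerman1993, Thm. 1.0.2] -/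
theorem recursO_minkowski_vacuumCauchyDevelopment (k : ℕ) :
    RecursO k Minkowski.vacuumCauchyDevelopment := by
  refine ⟨minkowskiExterior, 0, Fin.elim0, Fin.elim0, Fin.elim0, 0, fun i ↦ i.elim0, Fin.elim0,
    Fin.elim0, ⊤, idFlatChart, fun i ↦ i.elim0, fun i ↦ i.elim0, isLateChart_idFlatChart,
    fun i ↦ i.elim0, fun i ↦ i.elim0, fun _ _ ↦ trivial, fun _ ↦ ⟨0, fun i ↦ i.elim0⟩, ?_,
    raysStayInClosure_minkowski, fun τ₁ _ ↦ ?_, ⟨fun i ↦ i.elim0, fun τ _ x _ ↦ ?_⟩,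
    fun τ _ ↦ ⟨?_, fun i ↦ i.elim0⟩, fun R' ε _ ↦ ?_⟩
  · -- C8: `O = {x⁰ ≥ 0}` is the self-determined exterior of the charted late region `{x⁰ > 0}`
    rw [iUnion_of_empty, empty_union]
    have h := minkowskiExterior_eq_exteriorOf
    rw [charted_minkowskiDecomp, ← image_idFlatChart_lateRegion 0] at h
    exact h
  · -- C10: exhaustion at every `τ₁ > 0` (a point of `O` not later than `τ₁` lies below `(τ₁, x̲)`)
    rw [iUnion_of_empty, union_empty, iUnion_of_empty, union_empty]
    rintro x ⟨-, hx⟩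
    change E4 at x
    have hxle : x 0 ≤ τ₁ := by
      refine not_lt.mp fun hlt ↦ hx ?_
      have : x ∈ (idFlatChart '' (Minkowski.backgroundOn ⊤).lateRegion τ₁ : Set E4) := by
        rw [image_idFlatChart_lateRegion]; exact hlt
      exact this
    have hmem : E4.ofTimeSpace τ₁ (E4.spatial x) ∈
        (idFlatChart '' (Minkowski.backgroundOn ⊤).timeSlab τ₁ : Set E4) := by
      rw [image_idFlatChart_timeSlab]; exact E4.ofTimeSpace_apply_zero τ₁ _
    refine LorentzianMetric.causalFuture_mono
      (τ := TimeOrientation.reverse Minkowski.vacuumCauchyDevelopment.timeOrientation)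
      (singleton_subset_iff.mpr hmem) (Minkowski.mem_causalPast_vacuumCauchyDevelopment ?_)
    simp only [E4.spatial_ofTimeSpace, sub_self, norm_zero, E4.ofTimeSpace_apply_zero, sub_nonneg]
    exact hxle
  · -- C11: the identity chart pushes `∂₀` to `∂ₜ`, future-directed at every point of every slab
    change Minkowski.spacetime.timeOrientation.IsFutureDirected
      (mfderiv 𝓘(ℝ, E4) (𝓡 4) idFlatChart x (E4.basisVector 0))
    have hd : mfderiv 𝓘(ℝ, E4) (𝓡 4) idFlatChart x (E4.basisVector 0) = E4.basisVector 0 := by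
      change mfderiv 𝓘(ℝ, E4) 𝓘(ℝ, E4) (Subtype.val : (⊤ : Opens E4) → E4) x (E4.basisVector 0) = _
      rw [mfderiv_subtypeVal]
      rfl
    rw [hd]
    exact Minkowski.spacetime.timeOrientation.isFutureDirected_vectorField (x : E4)
  · -- C12: the uniform `C⁰` anchor — the deviation is `0`
    exact (Minkowski.deviationCk_vacuumCauchyDevelopment_subtypeVal 0 τ).trans_le zero_le
  · -- C13: recurrence at order `k` — the deviation is `0` at every time; no hole to orient
    exact Frequently.of_forall fun τ ↦
      ⟨(Minkowski.deviationCk_vacuumCauchyDevelopment_subtypeVal k τ).trans_le zero_le,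
        fun i ↦ i.elim0⟩

/-- **Both disjuncts of the rev-21 crux hold at one development**: the Minkowski development settles in
the T2 sense (`TrivialDatum.settlesT2_minkowski`) AND recurs in the oriented interface at every order.
[cite: ChristodoulouKlainerman1993, Thm. 1.0.2] -/
theorem settlesT2_and_recursO_minkowski :
    SettlesT2 Minkowski.vacuumCauchyDevelopment ∧ ∀ k, RecursO k Minkowski.vacuumCauchyDevelopment :=
  ⟨settlesT2_minkowski, recursO_minkowski_vacuumCauchyDevelopment⟩

/-- **At the Minkowski development the matrix of the crux's property holds for every order**: it
settles in the T2 sense, so `¬ SettlesT2 → RecursO k` fires trivially — and `RecursO k` holds there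
anyway (`recursO_minkowski_vacuumCauchyDevelopment`), so the implication is not satisfied vacuously
either. [cite: ChristodoulouKlainerman1993, Thm. 1.0.2] -/
theorem omegaProperty_minkowski (k : ℕ) :
    (¬ SettlesT2 Minkowski.vacuumCauchyDevelopment → RecursO k Minkowski.vacuumCauchyDevelopment) ∧
      RecursO k Minkowski.vacuumCauchyDevelopment :=
  ⟨fun _ ↦ recursO_minkowski_vacuumCauchyDevelopment k, recursO_minkowski_vacuumCauchyDevelopment k⟩

end Summit.FinalStateConjecture.FinalStateConjecture.Theorems.OmegaLimitMultiKerr.Negative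

end
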